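import Mathlib.Algebra.BigOperators.Fin
import Mathlib.Algebra.MvPolynomial.Monad
import Mathlib.Data.List.GetD
import Mathlib.LinearAlgebra.Matrix.NonsingularInverse
import Mathlib.LinearAlgebra.Vandermonde
import Mathlib.RingTheory.MvPolynomial.Homogeneous
import Literature.Computability.AlgebraicComplexity.ArithCircuit
import HarnessLib

/-!
# Scaled copies of a straight-line program and interpolation of homogeneous components

Generic ingredients of the classical *homogenisation by interpolation* of arithmetic circuits
(Strassen 1973; Bürgisser 2000, §2.1): over a field with enough elements, the homogeneous
component of degree `m` of a polynomial `p` of degree `≤ d` is a fixed linear combination — the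
`m`-th row of the inverse Vandermonde matrix — of the `d + 1` rescaled polynomials `p(t_k • x)`,
and a circuit for `p(t • x)` is obtained from one for `p` by a gate-local transformation.

* `ArithCircuit.foldl_map_of_eval_map`, `ArithCircuit.gateValues_append_map_of_eval_map`,
  `ArithCircuit.gateValues_flatMap_range_map`: the value list (`ArithCircuit.gateValues`) of a
  gate list followed by transformed copies of another gate list, when the transformation `T k`
  is *semantic* (`(T k g).eval (pre ++ vals.map φₖ) = φₖ (g.eval vals)`);
* `ArithCircuit.length_flatMap_range_map`, `ArithCircuit.getElem?_flatMap_range_map`: indexing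
  into `K` concatenated transformed copies of a list;
* `ArithCircuit.Gate.eval_scaleShift`, `ArithCircuit.Gate.fanIn_scaleShift`: semantics and fan-in
  of the scale-and-shift gate transformation (sum gates: the coefficient of a variable operand is
  multiplied by `t`; product gates: the constant operand `t` is inserted before each variable
  operand; gate references shifted by `off`). The transformation is characterised by its defining
  equations (hypotheses `hTs`, `hTp`, …), so that users may realise it by any concrete function;
* `bind₁_C_mul_X_of_isHomogeneous`: `φ(t • x) = t ^ m · φ(x)` for `φ` homogeneous of degree `m`;
* `vandermonde_inv_sum_bind₁_eq_homogeneousComponent`: the interpolation identity.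

Design note: no new definitions; everything is stated for the tree's `ArithCircuit.Gate.eval` /
`ArithCircuit.gateValues` fold semantics and Mathlib's `MvPolynomial.bind₁`,
`MvPolynomial.homogeneousComponent`, `Matrix.vandermonde`.
-/

noncomputable section

open MvPolynomial

namespace Literature.Computability.AlgebraicComplexity

universe u v

namespace ArithCircuit

variable {k : Type u} {σ : Type v} [CommSemiring k]

/-- If a gate transformation `T` turns evaluation against `pre ++ vals.map φ` into `φ` of the
evaluation against `vals`, then folding the transformed gates over the prefix `pre` yields `pre`
followed by the `φ`-image of the original value list (one induction along the fold defining
`gateValues`). [folklore] -/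
theorem foldl_map_of_eval_map (pre : List (MvPolynomial σ k))
    (φ : MvPolynomial σ k → MvPolynomial σ k) (T : Gate k σ → Gate k σ)
    (hT : ∀ (g : Gate k σ) (vals : List (MvPolynomial σ k)),
      (T g).eval (pre ++ vals.map φ) = φ (g.eval vals))
    (gs : List (Gate k σ)) (vals : List (MvPolynomial σ k)) :
    (gs.map T).foldl (fun vals g => vals ++ [g.eval vals]) (pre ++ vals.map φ) =
      pre ++ (gs.foldl (fun vals g => vals ++ [g.eval vals]) vals).map φ := by
  induction gs generalizing vals with
  | nil => simp
  | cons g rest ih =>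
    simp only [List.map_cons, List.foldl_cons]
    rw [hT, List.append_assoc]
    have h : vals.map φ ++ [φ (g.eval vals)] = (vals ++ [g.eval vals]).map φ := by
      simp [List.map_append]
    rw [h, ih]

/-- Value list of a gate list `gs0` followed by a semantically transformed copy of `gs`: the copy
contributes the `φ`-image of the value list of `gs`. [folklore] -/
theorem gateValues_append_map_of_eval_map (gs0 gs : List (Gate k σ))
    (φ : MvPolynomial σ k → MvPolynomial σ k) (T : Gate k σ → Gate k σ)
    (hT : ∀ (g : Gate k σ) (vals : List (MvPolynomial σ k)),
      (T g).eval (gateValues gs0 ++ vals.map φ) = φ (g.eval vals)) :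
    gateValues (gs0 ++ gs.map T) = gateValues gs0 ++ (gateValues gs).map φ := by
  unfold gateValues
  rw [List.foldl_append]
  have := foldl_map_of_eval_map (gateValues gs0) φ T hT gs []
  simpa [gateValues] using this

/-- Length of a concatenation of `K` transformed copies of a list. [folklore] -/
theorem length_flatMap_range_map {α β : Type*} (gs : List α) (T : ℕ → α → β) (K : ℕ) :
    ((List.range K).flatMap fun j => gs.map (T j)).length = K * gs.length := by
  induction K with
  | zero => simp
  | succ K ih =>
    rw [List.range_succ, List.flatMap_append, List.length_append, ih, List.flatMap_singleton,
      List.length_map]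
    ring

/-- Indexing into a concatenation of `K` transformed copies of a list: position `j * |gs| + i`
holds the `T j`-image of `gs[i]`. [folklore] -/
theorem getElem?_flatMap_range_map {α β : Type*} (gs : List α) (T : ℕ → α → β) :
    ∀ (K j i : ℕ), j < K → i < gs.length →
      ((List.range K).flatMap fun j => gs.map (T j))[j * gs.length + i]? = (gs[i]?).map (T j) := by
  intro K
  induction K with
  | zero => intro j i hj; exact absurd hj (Nat.not_lt_zero _)
  | succ K ih =>
    intro j i hj hi
    rw [List.range_succ, List.flatMap_append, List.flatMap_singleton]
    rcases Nat.lt_or_ge j K with hjK | hjK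
    · rw [List.getElem?_append_left, ih j i hjK hi]
      rw [length_flatMap_range_map]
      calc j * gs.length + i < j * gs.length + gs.length := by omega
        _ = (j + 1) * gs.length := by ring
        _ ≤ K * gs.length := Nat.mul_le_mul_right _ hjK
    · obtain rfl : j = K := by omega
      rw [List.getElem?_append_right, length_flatMap_range_map, Nat.add_sub_cancel_left,
        List.getElem?_map]
      rw [length_flatMap_range_map]
      omega

/-- Value list of `K` semantically transformed copies of a gate list: it has length `K * |gs|` and
block `j` holds the `φ j`-image of the original value list. [folklore] -/
theorem gateValues_flatMap_range_map (gs : List (Gate k σ)) (T : ℕ → Gate k σ → Gate k σ)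
    (φ : ℕ → MvPolynomial σ k → MvPolynomial σ k) (hφ0 : ∀ j, φ j 0 = 0)
    (hT : ∀ (j : ℕ) (pre vals : List (MvPolynomial σ k)), pre.length = j * gs.length →
      ∀ g : Gate k σ, (T j g).eval (pre ++ vals.map (φ j)) = φ j (g.eval vals)) :
    ∀ K : ℕ,
      (gateValues ((List.range K).flatMap fun j => gs.map (T j))).length = K * gs.length ∧
      ∀ j i : ℕ, j < K → i < gs.length →
        (gateValues ((List.range K).flatMap fun j => gs.map (T j))).getD (j * gs.length + i) 0
          = φ j ((gateValues gs).getD i 0) := by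
  intro K
  induction K with
  | zero =>
    refine ⟨by simp [gateValues], ?_⟩
    intro j i hj
    exact absurd hj (Nat.not_lt_zero _)
  | succ K ih =>
    obtain ⟨hlen, hval⟩ := ih
    have hstep : gateValues ((List.range (K + 1)).flatMap fun j => gs.map (T j)) =
        gateValues ((List.range K).flatMap fun j => gs.map (T j)) ++ (gateValues gs).map (φ K) := by
      rw [List.range_succ, List.flatMap_append, List.flatMap_singleton]
      exact gateValues_append_map_of_eval_map _ gs (φ K) (T K) (fun g vals => hT K _ vals hlen g)
    refine ⟨?_, ?_⟩
    · rw [hstep, List.length_append, hlen, List.length_map, gateValues_length]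
      ring
    · intro j i hj hi
      rw [hstep]
      rcases Nat.lt_or_ge j K with hjK | hjK
      · rw [List.getD_append _ _ _ _ ?_, hval j i hjK hi]
        rw [hlen]
        calc j * gs.length + i < j * gs.length + gs.length := by omega
          _ = (j + 1) * gs.length := by ring
          _ ≤ K * gs.length := Nat.mul_le_mul_right _ hjK
      · obtain rfl : j = K := by omega
        rw [List.getD_append_right _ _ _ _ (by rw [hlen]; omega), hlen, Nat.add_sub_cancel_left]
        have h := List.getD_map (l := gateValues gs) (n := i) (d := (0 : MvPolynomial σ k)) (φ j)
        rw [hφ0] at h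
        exact h

/-- Semantics of the *scale-and-shift* gate transformation `T` (scaling point `t`, offset `off`),
characterised by its defining equations: in a sum gate the coefficient of every variable operand
is multiplied by `t` (`cs`), in a product gate the constant operand `t` is inserted before every
variable operand (`E`), and all gate references are shifted by `off`. Evaluated against
`pre ++ vals.map φ_t` with `|pre| = off` and `φ_t = bind₁ (x ↦ C t * X x)` the rescaling of the
variables, the transformed gate yields `φ_t` of the original value: rescaling the inputs of a
straight-line program rescales every intermediate result (Strassen 1973). [folklore] -/
theorem Gate.eval_scaleShift (t : k) (off : ℕ) (T : Gate k σ → Gate k σ)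
    (E : Operand k σ → List (Operand k σ)) (cs : k × Operand k σ → k)
    (hTs : ∀ args, T (.sum args) = .sum (args.map fun a => (cs a, a.2.shift off)))
    (hTp : ∀ args, T (.prod args) = .prod (args.flatMap E))
    (hEv : ∀ i, E (.var i) = [.const t, .var i]) (hEc : ∀ c, E (.const c) = [.const c])
    (hEg : ∀ j, E (.gate j) = [.gate (j + off)])
    (hcv : ∀ c i, cs (c, .var i) = c * t) (hcc : ∀ c c', cs (c, .const c') = c)
    (hcg : ∀ c j, cs (c, .gate j) = c)
    (pre vals : List (MvPolynomial σ k)) (hpre : pre.length = off) (g : Gate k σ) :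
    (T g).eval (pre ++ vals.map (bind₁ fun x => C t * X x)) =
      bind₁ (fun x => C t * X x) (g.eval vals) := by
  set φ : MvPolynomial σ k →ₐ[k] MvPolynomial σ k := bind₁ fun x => C t * X x with hφ
  have hshift : ∀ u : Operand k σ, (u.shift off).eval (pre ++ vals.map φ) = u.eval (vals.map φ) := by
    intro u
    have h := Operand.eval_shift_append pre (vals.map φ) u
    rwa [hpre] at h
  have hgetD : ∀ j, (vals.map φ).getD j 0 = φ (vals.getD j 0) := by
    intro j
    have h := List.getD_map (l := vals) (n := j) (d := (0 : MvPolynomial σ k)) φ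
    rwa [map_zero] at h
  have hflat : ∀ (l : List (Operand k σ)) (h : Operand k σ → MvPolynomial σ k),
      ((l.flatMap E).map h).prod = (l.map fun a => ((E a).map h).prod).prod := by
    intro l h
    induction l with
    | nil => simp
    | cons a l ih => simp [List.flatMap_cons, List.map_append, List.prod_append, ih]
  cases g with
  | sum args =>
    rw [hTs]
    simp only [Gate.eval, List.map_map, map_list_sum]
    congr 1
    apply List.map_congr_left
    intro a _
    obtain ⟨c, u⟩ := a
    simp only [Function.comp_apply]
    rw [hshift]
    cases u with
    | var i =>
      rw [hcv]
      simp only [Operand.eval, map_smul, hφ, bind₁_X_right]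
      rw [C_mul', smul_smul]
    | const c' =>
      rw [hcc]
      simp only [Operand.eval, map_smul, hφ, bind₁_C_right]
    | gate j =>
      rw [hcg]
      simp only [Operand.eval]
      rw [hgetD, map_smul]
  | prod args =>
    rw [hTp]
    simp only [Gate.eval, map_list_prod, List.map_map]
    rw [hflat]
    congr 1
    apply List.map_congr_left
    intro u _
    simp only [Function.comp_apply]
    cases u with
    | var i =>
      rw [hEv]
      simp only [List.map_cons, List.map_nil, List.prod_cons, List.prod_nil, mul_one,
        Operand.eval, hφ, bind₁_X_right]
    | const c' =>
      rw [hEc]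
      simp only [List.map_cons, List.map_nil, List.prod_cons, List.prod_nil, mul_one,
        Operand.eval, hφ, bind₁_C_right]
    | gate j =>
      rw [hEg]
      simp only [List.map_cons, List.map_nil, List.prod_cons, List.prod_nil, mul_one]
      have h := hshift (.gate j)
      simp only [Operand.shift] at h
      rw [h]
      simp only [Operand.eval]
      exact hgetD j

omit [CommSemiring k] in
/-- Fan-in of the scale-and-shift gate transformation: a sum gate keeps its fan-in; a product
gate's fan-in grows by at most a factor of two and never shrinks (each operand is replaced by one
or two operands). [folklore] -/
theorem Gate.fanIn_scaleShift (off : ℕ) (T : Gate k σ → Gate k σ)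
    (E : Operand k σ → List (Operand k σ)) (cs : k × Operand k σ → k)
    (hTs : ∀ args, T (.sum args) = .sum (args.map fun a => (cs a, a.2.shift off)))
    (hTp : ∀ args, T (.prod args) = .prod (args.flatMap E))
    (hE : ∀ u, 1 ≤ (E u).length ∧ (E u).length ≤ 2) (g : Gate k σ) :
    g.fanIn ≤ (T g).fanIn ∧ (T g).fanIn ≤ 2 * g.fanIn := by
  cases g with
  | sum args =>
    rw [hTs]
    simp only [Gate.fanIn, Gate.args, List.length_map]
    omega
  | prod args =>
    rw [hTp]
    simp only [Gate.fanIn, Gate.args]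
    induction args with
    | nil => simp
    | cons u rest ih =>
      simp only [List.flatMap_cons, List.length_append, List.length_cons]
      have h := hE u
      omega

end ArithCircuit

/-- Rescaling the variables of a homogeneous polynomial of degree `m` by `t` multiplies it by
`t ^ m`: `φ(t • x) = t ^ m · φ(x)`. [folklore] -/
theorem bind₁_C_mul_X_of_isHomogeneous {σ R : Type*} [CommSemiring R] (t : R)
    {φ : MvPolynomial σ R} {m : ℕ} (hφ : φ.IsHomogeneous m) :
    bind₁ (fun x => C t * X x) φ = C (t ^ m) * φ := by
  classical
  conv_lhs => rw [φ.as_sum, map_sum]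
  conv_rhs => rw [φ.as_sum, Finset.mul_sum]
  refine Finset.sum_congr rfl fun d hd => ?_
  have hdeg : m = ∑ i ∈ d.support, d i := hφ.degree_eq_sum_deg_support hd
  rw [bind₁_monomial]
  simp_rw [mul_pow, Finset.prod_mul_distrib, ← map_pow, ← map_prod, Finset.prod_pow_eq_pow_sum,
    ← hdeg]
  rw [monomial_eq, Finsupp.prod]
  simp only [← mul_assoc]
  rw [← map_mul, ← map_mul, mul_comm (coeff d φ)]

/-- **Interpolation of homogeneous components** (Strassen 1973; Bürgisser 2000, §2.1): for a
polynomial `p` of total degree `≤ d` over a field and `d + 1` distinct scaling points `v`, the `m`-th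
row of the inverse Vandermonde matrix of `v` applied to the rescaled polynomials `p(v_k • x)`
gives the `m`-th homogeneous component of `p` (`m ≤ d`). [folklore] -/
theorem vandermonde_inv_sum_bind₁_eq_homogeneousComponent {σ F : Type*} [Field F] (d m : ℕ)
    (hm : m < d + 1) (p : MvPolynomial σ F) (hp : p.totalDegree ≤ d) (v : Fin (d + 1) → F)
    (hv : Function.Injective v) :
    ∑ j : Fin (d + 1), (Matrix.vandermonde v)⁻¹ ⟨m, hm⟩ j • bind₁ (fun x => C (v j) * X x) p
      = homogeneousComponent m p := by
  classical
  set M := Matrix.vandermonde v with hM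
  have hdet : IsUnit M.det := by
    rw [isUnit_iff_ne_zero, hM, Matrix.det_vandermonde_ne_zero_iff]
    exact hv
  have hinv : M⁻¹ * M = 1 := Matrix.nonsing_inv_mul M hdet
  have hdecomp : p = ∑ i ∈ Finset.range (d + 1), homogeneousComponent i p := by
    conv_lhs => rw [← sum_homogeneousComponent p]
    apply Finset.sum_subset
    · exact Finset.range_subset_range.mpr (by omega)
    · intro i _ hi'
      apply homogeneousComponent_eq_zero
      simp only [Finset.mem_range, not_lt] at hi'
      omega
  have hscale : ∀ j : Fin (d + 1), bind₁ (fun x => C (v j) * X x) p =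
      ∑ i : Fin (d + 1), (v j ^ (i : ℕ)) • homogeneousComponent i p := by
    intro j
    conv_lhs => rw [hdecomp]
    rw [map_sum, ← Fin.sum_univ_eq_sum_range]
    refine Finset.sum_congr rfl fun i _ => ?_
    rw [bind₁_C_mul_X_of_isHomogeneous _ (homogeneousComponent_isHomogeneous _ p), C_mul']
  simp_rw [hscale, Finset.smul_sum, smul_smul]
  rw [Finset.sum_comm]
  simp_rw [← Finset.sum_smul]
  have hrow : ∀ i : Fin (d + 1),
      ∑ j : Fin (d + 1), M⁻¹ ⟨m, hm⟩ j * v j ^ (i : ℕ) = if (⟨m, hm⟩ : Fin (d + 1)) = i then 1 else 0 := by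
    intro i
    have h := congrFun (congrFun hinv ⟨m, hm⟩) i
    rw [Matrix.mul_apply, Matrix.one_apply] at h
    simpa [hM, Matrix.vandermonde_apply] using h
  simp_rw [hrow, ite_smul, one_smul, zero_smul, Finset.sum_ite_eq, Finset.mem_univ, if_true]

end Literature.Computability.AlgebraicComplexity
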